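import Literature.MathematicalPhysics.QuantumLattice.HubbardModel
import Literature.MathematicalPhysics.QuantumLattice.HubbardRectangularTorus
import Literature.MathematicalPhysics.QuantumLattice.HubbardBootstrapCertificate
import Literature.MathematicalPhysics.QuantumLattice.HubbardBootstrapCertificateResidual
import Literature.MathematicalPhysics.QuantumLattice.HeisenbergModel
import Literature.MathematicalPhysics.QuantumLattice.HubbardSpinChargeCertificate
import Literature.MathematicalPhysics.QuantumLattice.SectorGroundState
import Literature.MathematicalPhysics.QuantumLattice.HubbardTorusLocalCertificate
import Literature.MathematicalPhysics.QuantumLattice.HubbardTorus2DEnergyDensity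
import Literature.MathematicalPhysics.QuantumLattice.HubbardWindowCertificateD4
import Literature.MathematicalPhysics.QuantumLattice.HubbardCorrelatorCertificate
import Literature.MathematicalPhysics.QuantumLattice.HubbardCorrelatorCertificateAffine
import Literature.MathematicalPhysics.QuantumLattice.HubbardChainDoubleOccupancyLiebWu
import Literature.MathematicalPhysics.QuantumLattice.HubbardKineticEnergyDensity
import Literature.MathematicalPhysics.QuantumLattice.HeisenbergWindowCertificateSquare
import Literature.MathematicalPhysics.QuantumLattice.HubbardTorusLimitSpinCorrelationSign
import Literature.MathematicalPhysics.QuantumLattice.HubbardTorusChargeGapSpinGap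
import Literature.MathematicalPhysics.QuantumLattice.HubbardSzSectorMonotone
import Literature.MathematicalPhysics.QuantumLattice.HubbardHalfFilledSectorOrdering
import Literature.MathematicalPhysics.QuantumLattice.HubbardRingPerronFrobeniusProofs
import Literature.MathematicalPhysics.QuantumLattice.HubbardSectorCorrelatorCertificate
import Literature.MathematicalPhysics.QuantumLattice.HubbardOddSectorReduction
import Summits.HubbardSuperconductivity.HubbardLadder.HubbardMomentRows
import Summits.HubbardSuperconductivity.HubbardLadder.Bounds.TorusRayleighUpperRows
import HarnessLib
import HarnessLib.Audit
import Summits.HubbardSuperconductivity.ManyBodyBootstrap.Bounds.Defs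
import Summits.HubbardSuperconductivity.ManyBodyBootstrap.Bounds.EDTorusRows
import Summits.HubbardSuperconductivity.ManyBodyBootstrap.Bounds.SdpRows1
import Summits.HubbardSuperconductivity.ManyBodyBootstrap.Bounds.SdpRows2
import Summits.HubbardSuperconductivity.ManyBodyBootstrap.Bounds.SdpRows3
import Summits.HubbardSuperconductivity.ManyBodyBootstrap.Bounds.SdpRows4
import Summits.HubbardSuperconductivity.ManyBodyBootstrap.Bounds.SdpRows5
import Summits.HubbardSuperconductivity.ManyBodyBootstrap.Bounds.Corollaries1
import Summits.HubbardSuperconductivity.ManyBodyBootstrap.Bounds.Corollaries2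
import Summits.HubbardSuperconductivity.ManyBodyBootstrap.Bounds.Corollaries3
import Summits.HubbardSuperconductivity.ManyBodyBootstrap.Bounds.Corollaries4
import Summits.HubbardSuperconductivity.ManyBodyBootstrap.Bounds.Corollaries5
import Summits.HubbardSuperconductivity.ManyBodyBootstrap.Bounds.Corollaries6
import Summits.HubbardSuperconductivity.ManyBodyBootstrap.Bounds.OneHoleUpperRows
import Summits.HubbardSuperconductivity.ManyBodyBootstrap.Bounds.SdpRows6
import Summits.HubbardSuperconductivity.ManyBodyBootstrap.Bounds.Corollaries7
import Summits.HubbardSuperconductivity.ManyBodyBootstrap.Bounds.SdpRows7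
import Summits.HubbardSuperconductivity.ManyBodyBootstrap.Bounds.Corollaries8
import Summits.HubbardSuperconductivity.ManyBodyBootstrap.Bounds.SdpRows8
import Summits.HubbardSuperconductivity.ManyBodyBootstrap.Bounds.Corollaries9
import Summits.HubbardSuperconductivity.ManyBodyBootstrap.Bounds.Corollaries5
import Summits.HubbardSuperconductivity.ManyBodyBootstrap.Bounds.Defs

/-!
# Many-body bootstrap — Bounds: certificate claim nodes (new rows; see docstrings)

Part `SdpRows9` (1/2) of the cell's staged module `HubbardCertifiedBoundsNext.lean` (sha256 `3fb536e14beb78ad…`), filed under the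
cell topic `ManyBodyBootstrap` (lit seat pub-mbboot, tool `file_parts_g19.py`; unit→part table in HOME/PLACEMENT.md).
Declarations are the staged ones, byte-identical up to: namespace `Summit.HubbardSuperconductivity.Bounds` → `Summit.HubbardSuperconductivity.ManyBodyBootstrap.Bounds`,
`@[conjecture]` on every certificate CLAIM NODE (`def … : Prop`, an open obligation node closable in-kernel from the
certificate's exact data — NOT a vendored fact) and a closing `[computation: <format>, exact ℚ]` tag in its docstring.
Scope, provenance, certificate formats, verifiers and the PROVED soundness theorems are stated in the module docstring of
part `Defs` and in each row's docstring. HONEST FRAMING: certified numerical bounds on a lattice model; not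
superconductivity, not a phase diagram.
-/

noncomputable section

namespace Summit.HubbardSuperconductivity.ManyBodyBootstrap.Bounds

open Literature.MathematicalPhysics.QuantumLattice
open Summit.HubbardSuperconductivity.HubbardLadder (stagStructureFour)
open Summit.HubbardSuperconductivity.HubbardLadder (localMomentFour re_expect_localMomentFour)
open Summit.HubbardSuperconductivity.HubbardLadder.Bounds (torusUpper_mbbootE2_4x4_U8_N16 groundEnergyAt_rect_4x4_U8_N16_le_of_claim torusUpper_mbbootE2_4x4_U4_N16 groundEnergyAt_rect_4x4_U4_N16_le_of_claim)
open Summit.HubbardSuperconductivity.HubbardLadder.Bounds (torusUpper_mbbootE2_4x4_U2_N16 groundEnergyAt_rect_4x4_U2_N16_le_of_claim torusUpper_mbbootE2_4x4_U12_N16 groundEnergyAt_rect_4x4_U12_N16_le_of_claim)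
open Summit.HubbardSuperconductivity.HubbardLadder.Bounds (torusUpper_mbbootE2_4x4_U6_N16 groundEnergyAt_rect_4x4_U6_N16_le_of_claim)
open Literature.Probability.LatticeModels
open Filter Topology HubbardWave0 Literature.MathematicalPhysics.QuantumManyBody.StateRelaxation
open scoped Matrix

/-! ## part SdpRows9 -/
/-- Hubbard `4×4` torus (`fermionRectTorusGraph 4 4`; a side of length 2 is ONE bond), `t = 1`, `U = 6`, `N = 14` particles, all `S^z` (`groundEnergyAt`): moment-matrix lower bound `E₀(N) ≥ -8931334454639679779773703/604462909807314587353088 ≈ -14.775653410`. Soundness theorem: `groundEnergyAt_ge_of_certificate_charged`.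
certificate `cert_hub_torus4x4_U6_N14_b4eom.json.gz` (format certsdp/1; canonical sha256 `f82923c0bbf61bbaedde98acc4eeba3f445fb8db932bbed45d8de1dadb6fba1a`, gz file sha256 `0d9b21962447b21e7c1e8b088c3c9dcff17913b1b29faca40cbcc5decd9e1205`; producing job j098930; verifiers A and B recompute the claimed rational exactly);
basis `degree<=2 + bond<=4`, m = 5873 words, 80 equality rows [eom]; E_sdp (float, informative) -14.775634031, ℓ¹ rounding loss 1.91e-05; comparison adv-1 certified exact-Rayleigh upper -13.4212342 (N=14, S=(7,7); ed_upper_4x4_U6_N14_s7_7, typer g121) -13.421234200, rel. gap 1.01e-01; decimal floor -7387827/500000. [computation: certsdp/1, exact ℚ] -/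
@[conjecture] def sdp_lower_4x4_U6_N14_b4eom : Prop :=
  ((-8931334454639679779773703/604462909807314587353088 : ℚ) : ℝ) ≤ E₀ 4 4 1 6 14

end Summit.HubbardSuperconductivity.ManyBodyBootstrap.Bounds

end
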